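import Summits.Schanuel.Schanuel.Theorems.DiophantineDichotomyKhovanskiiApproxTypeEvLambertLiouville
import Summits.Schanuel.Schanuel.Theorems.DiophantineDichotomyKhovanskiiApproxTypeEvLambertExpRationalPoint
import Summits.Schanuel.Schanuel.Theorems.DiophantineDichotomyKhovanskiiApproxTypeEvLambertLiouvilleWindowInt
import Summits.Schanuel.Schanuel.Theorems.DiophantineDichotomyKhovanskiiApproxTypeEvLambertExpRationalSlotHeight
import Summits.Schanuel.Schanuel.Theorems.DiophantineDichotomyKhovanskiiApproxTypeEvLambertExpRationalLevel
import Summits.Schanuel.Schanuel.Theorems.DiophantineDichotomyKhovanskiiApproxTypeEvLambertExpRationalLipschitz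
import Summits.Schanuel.Schanuel.Theorems.DiophantineDichotomyKhovanskiiApproxTypeEvLambertExpRationalDist
import HarnessLib

/-!
# Route `DiophantineDichotomy`, crux `KhovanskiiApproxTypeEv` (stmt-Schanuel-14972), line `lambert-liouville-kill`:
# the GENERAL EXP-RATIONAL (Lambert-tied slot) hardness certificate `notLiouville_expRational_of_ev` — the crux
# implies that NO non-degenerate exp-rational point is a Liouville number

Crux `Summit.Schanuel.Schanuel.Theses.DiophantineDichotomy.KhovanskiiApproxTypeEv` (item stmt-Schanuel-14972).
Third composition file of the certificate line `lambert-liouville-kill` (lead `prover-line-stmt-Schanuel-14972-a1-0`;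
extension skeleton `Cruxes/KhovanskiiApproxTypeEv/Lines/lambert_liouville_kill_expRational.lean`).  The landed
certificate `notLiouville_lambert_of_ev` (`…LambertLiouville.lean`, p128146) covers the Lambert numbers `W(1/k)`;
this file closes, SORRY-FREE and with NO named-fact hypothesis, the registered sub-goal

  `notLiouville_expRational_of_ev : KhovanskiiApproxTypeEv → ∀ (A B : ℤ[X]) (x : ℝ),
      A(x)·eˣ = B(x) → eˣ(A(x) + A′(x)) ≠ B′(x) → ¬ Liouville x`

i.e. the crux (at `n = 2`, threshold `a < 1`) forbids EVERY real simple zero `x` of an exponential polynomial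
`A(t)eᵗ − B(t)` over `ℤ` — the Lambert numbers `W(r)`, `r ∈ ℚ_{>0}` (`A = vX`, `B = u`), the omega constant,
… — to be a Liouville number.  This is the precise content of the planners' kill criterion Z′ ("Lambert-tied
slots") for any restatement of the crux: a measure-shaped crux over all free Khovanskii points contains an
irrationality-measure statement for every such `x`, none of which is implied by Schanuel's conjecture or in print.

## The argument
As in `notLiouville_lambert_of_ev`, with the Lambert slot `eˣ = 1/(kx)` replaced by `eˣ = B(x)/A(x)`:
`s = (1, x)` is a free Khovanskii point (`stub_expRationalPoint`: system `z₀ − 1`, `A(z₁)y₁ − B(z₁)`); at a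
Liouville scale `q` of `x` (`stub_liouvilleWindowInt`) the challenger `(1, p/q, α, B(p/q)/A(p/q))` — `α` the Diaz
approximant of `e` synchronised (`stub_syncDiaz`, through the per-degree measure `stub_expOneDegreeMeasure`) to
the scale `Q = c₁ q^{D+1}` that dominates the height of the rational slot (`stub_expRationalSlotHeight`) — has
level `(n, H)`, `Q ≤ H ≤ Q^{M₀}` (`stub_expRationalLevel`) and sup-distance `≤ max(H^{−n/200}, K q^{−m})`
(`stub_expRationalLipschitz`, `stub_expRationalDist`), which beats `exp(−C(nᵃ log H + nᵇ))` (`stub_endgame` with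
window exponent `(D+2)M₀`) — contradiction past the crux's threshold `H₀(n)`.  If `A(x) = 0` then `x` is
algebraic and cannot be Liouville.

## Contents
* `height_window_rpow`, `expRational_sizes` — bookkeeping;
* `notLiouville_expRational_of_ev` — the registered certificate;
* `notLiouville_lambertW_of_ev` — corollary: no Lambert number `W(v/u)`, `u, v ≥ 1`, is Liouville.
-/

noncomputable section

-- `Summit.Schanuel.Schanuel.…` is the mandated summit/sub-problem namespace (single-conjunct summit), hence:
set_option linter.dupNamespace false

open scoped BigOperators

namespace Summit.Schanuel.Schanuel.Cruxes.KhovanskiiApproxTypeEv.LambertLiouvilleKill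

open Summit.Schanuel.Schanuel.Theses.DiophantineDichotomy (KhovanskiiApproxTypeEv)
open Summit.Schanuel.Schanuel.Cruxes.KhovanskiiApproxType.LwSmallHeight (IsFreeKhovanskii)
open Summit.Schanuel.Schanuel.Cruxes.KhovanskiiApproxTypeEv.AnchoredReduction
  (ApproxTypeEvAt khovanskiiApproxTypeEv_iff)
open Polynomial Complex

/-! ## Bookkeeping -/

/-- A window-exponent bookkeeping lemma: for naturals `1 ≤ c₁ ≤ q` and reals `M₀ > 0`, `H ≤ (c₁ q^{D+1})^{M₀}`
implies `H ≤ q^{(D+2) M₀}`. [folklore] -/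
theorem height_window_rpow (c₁ q D : ℕ) (M₀ H : ℝ) (hc₁ : 1 ≤ c₁) (hcq : c₁ ≤ q) (hM₀ : 0 < M₀)
    (hH : H ≤ ((c₁ * q ^ (D + 1) : ℕ) : ℝ) ^ M₀) : H ≤ (q : ℝ) ^ (((D : ℝ) + 2) * M₀) := by
  have hq1 : (1 : ℝ) ≤ q := by exact_mod_cast hc₁.trans hcq
  have hq0 : (0 : ℝ) ≤ q := by linarith
  refine hH.trans ?_
  have h1 : ((c₁ * q ^ (D + 1) : ℕ) : ℝ) ≤ (q : ℝ) ^ (D + 2) := by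
    have : ((c₁ * q ^ (D + 1) : ℕ) : ℝ) = (c₁ : ℝ) * (q : ℝ) ^ (D + 1) := by push_cast; ring
    rw [this, pow_succ (q : ℝ) (D + 1)]
    rw [mul_comm]
    exact mul_le_mul_of_nonneg_left (by exact_mod_cast hcq) (by positivity)
  calc ((c₁ * q ^ (D + 1) : ℕ) : ℝ) ^ M₀ ≤ ((q : ℝ) ^ (D + 2)) ^ M₀ :=
        Real.rpow_le_rpow (by positivity) h1 hM₀.le
    _ = (q : ℝ) ^ (((D : ℝ) + 2) * M₀) := by
        rw [← Real.rpow_natCast, ← Real.rpow_mul hq0]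
        push_cast
        ring_nf

/-- Size bookkeeping for the exp-rational challenger: with `max(|p|, q) ≤ X₀ q`, `L, X₀, q ≥ 1`, both
`L · max(|p|, q)^D` and `X₀ q` are at most `Q = L X₀^{D+1} q^{D+1}`. [folklore] -/
theorem expRational_sizes (L X₀ D q : ℕ) (p : ℤ) (hL1 : 1 ≤ L) (hX₀1 : 1 ≤ X₀) (hq1 : 1 ≤ q)
    (hmax : max |p| (q : ℤ) ≤ (X₀ : ℤ) * q) :
    (L : ℤ) * (max |p| (q : ℤ)) ^ D ≤ ((L * X₀ ^ (D + 1) * q ^ (D + 1) : ℕ) : ℤ) ∧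
      (X₀ : ℤ) * q ≤ ((L * X₀ ^ (D + 1) * q ^ (D + 1) : ℕ) : ℤ) := by
  have hmax0 : 0 ≤ max |p| (q : ℤ) := le_trans (abs_nonneg p) (le_max_left _ _)
  have hL0 : (0 : ℤ) ≤ L := by positivity
  have hL1' : (1 : ℤ) ≤ L := by exact_mod_cast hL1
  have hX1 : (1 : ℤ) ≤ X₀ := by exact_mod_cast hX₀1
  have hq1' : (1 : ℤ) ≤ q := by exact_mod_cast hq1
  have hX : (X₀ : ℤ) ^ D ≤ X₀ ^ (D + 1) := pow_le_pow_right₀ hX1 (by omega)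
  have hqq : (q : ℤ) ^ D ≤ q ^ (D + 1) := pow_le_pow_right₀ hq1' (by omega)
  have hXD : (X₀ : ℤ) ≤ X₀ ^ (D + 1) := by
    calc (X₀ : ℤ) = X₀ ^ 1 := (pow_one _).symm
      _ ≤ X₀ ^ (D + 1) := pow_le_pow_right₀ hX1 (by omega)
  have hqD : (q : ℤ) ≤ q ^ (D + 1) := by
    calc (q : ℤ) = q ^ 1 := (pow_one _).symm
      _ ≤ q ^ (D + 1) := pow_le_pow_right₀ hq1' (by omega)
  push_cast
  constructor
  · calc (L : ℤ) * (max |p| (q : ℤ)) ^ D ≤ L * ((X₀ : ℤ) * q) ^ D :=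
          mul_le_mul_of_nonneg_left (pow_le_pow_left₀ hmax0 hmax D) hL0
      _ = (L * X₀ ^ D) * q ^ D := by ring
      _ ≤ (L * X₀ ^ (D + 1)) * q ^ (D + 1) :=
          mul_le_mul (mul_le_mul_of_nonneg_left hX hL0) hqq (by positivity) (by positivity)
  · calc (X₀ : ℤ) * q ≤ X₀ ^ (D + 1) * q ^ (D + 1) :=
          mul_le_mul hXD hqD (by positivity) (by positivity)
      _ ≤ L * (X₀ ^ (D + 1) * q ^ (D + 1)) := le_mul_of_one_le_left (by positivity) hL1'
      _ = L * X₀ ^ (D + 1) * q ^ (D + 1) := by ring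

/-! ## The certificate -/

/-- **`KhovanskiiApproxTypeEv` ⟹ no non-degenerate exp-rational point is Liouville.**  If `x ∈ ℝ` satisfies
`A(x) eˣ = B(x)` with `A, B ∈ ℤ[X]` and `eˣ(A(x) + A′(x)) ≠ B′(x)` (so `s = (1, x)` is a free Khovanskii point,
F1), then the crux at `n = 2` (threshold `a < 1`) forbids `x` to be Liouville: at a Liouville scale `q`
(`|x − p/q| ≤ q^{−m}`, F2) the challenger `(1, p/q, α, B(p/q)/A(p/q))` — `α` the Diaz approximant of `e`
synchronised to the scale `Q = c₁ q^{D+1}` (`stub_syncDiaz`), the last slot a rational of height `≤ Q` (F3a) at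
distance `≤ K|x − p/q|` from `eˣ = B(x)/A(x)` (F4) — has level `(n, H)`, `Q ≤ H ≤ Q^{M₀}` (F3b), and distance
`≤ max(H^{−n/200}, K q^{−m}) < exp(−C(nᵃ log H + nᵇ))` (F4b, `stub_endgame`) — contradiction past the
threshold `H₀(n)`.  Covers `x = W(r)`, `r ∈ ℚ_{>0}` (`A = vX`, `B = u`) and every real simple zero of an
exponential polynomial `A(t)eᵗ − B(t)` over `ℤ`; if `A(x) = 0` the point is algebraic and the claim is
Liouville's theorem. [folklore] -/
theorem notLiouville_expRational_of_ev :
    KhovanskiiApproxTypeEv → ∀ (A B : ℤ[X]) (x : ℝ),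
      Polynomial.aeval x A * Real.exp x = Polynomial.aeval x B →
      Real.exp x * (Polynomial.aeval x A + Polynomial.aeval x (Polynomial.derivative A)) ≠
        Polynomial.aeval x (Polynomial.derivative B) →
      ¬ Liouville x := by
  intro hEv A B x hrel hJ hL
  -- x is transcendental, hence A(x) ≠ 0
  have hxT : Transcendental ℤ x := hL.transcendental
  have halg : ∀ R : ℤ[X], R ≠ 0 → Polynomial.aeval x R = 0 → False :=
    fun R hR0 hRx => hxT ⟨R, hR0, hRx⟩
  have hA : Polynomial.aeval x A ≠ 0 := by
    intro hA0
    have hB0 : Polynomial.aeval x B = 0 := by rw [← hrel, hA0, zero_mul]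
    by_cases hA00 : A = 0
    · subst hA00
      have hB' : Polynomial.aeval x (derivative B) ≠ 0 := by
        intro h; apply hJ; simp [h]
      have hBne : B ≠ 0 := by
        rintro rfl; exact hB' (by simp)
      exact halg B hBne hB0
    · exact halg A hA00 hA0
  -- the point (complexified) and the crux at n = 2
  have castA : ∀ R : ℤ[X], Polynomial.aeval (x : ℂ) R = ((Polynomial.aeval x R : ℝ) : ℂ) := by
    intro R
    rw [← Complex.coe_algebraMap, Polynomial.aeval_algebraMap_apply]
  have hrelC : Polynomial.aeval (x : ℂ) A * Complex.exp x = Polynomial.aeval (x : ℂ) B := by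
    rw [castA, castA, ← Complex.ofReal_exp]; exact_mod_cast hrel
  have hJC : Complex.exp x * (Polynomial.aeval (x : ℂ) A + Polynomial.aeval (x : ℂ) (derivative A)) -
      Polynomial.aeval (x : ℂ) (derivative B) ≠ 0 := by
    rw [castA, castA, castA, ← Complex.ofReal_exp]
    have h : Real.exp x * (Polynomial.aeval x A + Polynomial.aeval x (derivative A)) -
        Polynomial.aeval x (derivative B) ≠ 0 := sub_ne_zero.mpr hJ
    exact_mod_cast h
  have hfree : IsFreeKhovanskii 2 ![(1 : ℂ), (x : ℂ)] := stub_expRationalPoint A B x hrelC hJC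
  have hli : LinearIndependent ℚ ![(1 : ℂ), (x : ℂ)] := linearIndependent_one_real x hL.irrational
  obtain ⟨a, b, C, ha, hC, hall⟩ := (khovanskiiApproxTypeEv_iff.1 hEv) 2 _ le_rfl hli hfree
  have ha1 : a < 1 := by
    have h1 : (1 : ℝ) / (((2 : ℕ) : ℝ) - 1) = 1 := by norm_num
    rw [h1] at ha
    exact ha
  -- slot data: Lipschitz constant and height of B/A at rationals
  obtain ⟨K, δ, hK1, hδ, hLip⟩ := stub_expRationalLipschitz A B x hA
  have hK0 : 0 ≤ K := by linarith
  obtain ⟨L, D, hL1, hslot⟩ := stub_expRationalSlotHeight A B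
  -- budget n, synchronised Diaz data, window exponent and endgame data
  obtain ⟨n, hn50, hend⟩ := stub_endgame a b C K ha1 hC hK0
  obtain ⟨M₀, hM₀, q₁, hq₁⟩ := stub_syncDiaz stub_expOneDegreeMeasure n hn50
  have hn1 : 1 ≤ n := by omega
  set X₀ : ℕ := ⌈|x|⌉₊ + 2 with hX₀
  set c₁ : ℕ := L * X₀ ^ (D + 1) with hc₁
  have hX₀1 : 1 ≤ X₀ := by omega
  have hc₁1 : 1 ≤ c₁ := Nat.one_le_iff_ne_zero.mpr (mul_ne_zero (by omega) (pow_ne_zero _ (by omega)))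
  have hM₀' : 0 < ((D : ℝ) + 2) * M₀ := by positivity
  obtain ⟨m, q₀, hfin⟩ := hend (((D : ℝ) + 2) * M₀) hM₀'
  -- threshold of the eventual crux at budget n
  obtain ⟨H₀, hH₀⟩ := hall n
  -- the Liouville scale q and the synchronisation scale Q = c₁ q^{D+1}
  set N : ℕ := max (max (max H₀ q₁) ⌈q₀⌉₊) c₁ with hN
  obtain ⟨p, q, hNq, hq1, hclose, hwin⟩ :=
    stub_liouvilleWindowInt x (min δ 1) hL (lt_min hδ one_pos) m N
  have hc₁q : c₁ ≤ q := le_trans (le_max_right _ _) hNq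
  have hq₀q : q₀ ≤ (q : ℝ) := by
    have h1 : ⌈q₀⌉₊ ≤ q := le_trans (le_trans (le_max_right _ _) (le_max_left _ _)) hNq
    exact (Nat.le_ceil q₀).trans (by exact_mod_cast h1)
  set Q : ℕ := c₁ * q ^ (D + 1) with hQ
  have hqQ : q ≤ Q := by
    calc q = 1 * q ^ 1 := by ring
      _ ≤ c₁ * q ^ (D + 1) := Nat.mul_le_mul hc₁1 (Nat.pow_le_pow_right hq1 (by omega))
  have hq₁Q : q₁ ≤ Q :=
    le_trans (le_trans (le_trans (le_trans (le_max_right _ _) (le_max_left _ _)) (le_max_left _ _)) hNq) hqQ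
  -- the synchronised approximant of e at the scale Q
  obtain ⟨α, P, H, hP0, hPα, hPdeg, hPcoef, hQH, hHQ, hqual⟩ := hq₁ Q hq₁Q
  have hqH : q ≤ H := hqQ.trans hQH
  have hH₀H : H₀ ≤ H :=
    le_trans (le_trans (le_trans (le_trans (le_max_left _ _) (le_max_left _ _)) (le_max_left _ _)) hNq) hqH
  -- the slot t = p/q: A(t) ≠ 0, Lipschitz bound, integers u, v
  have ht : |(p : ℝ) / q - x| < δ := by
    rw [abs_sub_comm]; exact lt_of_lt_of_le hwin (min_le_left _ _)
  obtain ⟨hAt, hLipt⟩ := hLip ((p : ℝ) / q) ht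
  obtain ⟨u, v, hu0, huv, hu, hv⟩ := hslot p q hq1 hAt
  -- size bookkeeping: |p| ≤ X₀ q, so q, |p|, |u|, |v| ≤ Q ≤ H
  have hqpos : (0 : ℝ) < q := by exact_mod_cast hq1
  have hpq : |(p : ℝ)| ≤ (X₀ : ℝ) * q := by
    have h1 : |(p : ℝ) / q| ≤ |x| + 1 := by
      have h2 : |(p : ℝ) / q - x| ≤ 1 := by
        rw [abs_sub_comm]; exact (le_of_lt hwin).trans (min_le_right _ _)
      calc |(p : ℝ) / q| = |((p : ℝ) / q - x) + x| := by ring_nf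
        _ ≤ |(p : ℝ) / q - x| + |x| := abs_add_le _ _
        _ ≤ |x| + 1 := by linarith
    have h3 : |(p : ℝ)| = |(p : ℝ) / q| * q := by
      rw [abs_div, abs_of_pos hqpos, div_mul_cancel₀ _ hqpos.ne']
    have h4 : |x| + 1 ≤ (X₀ : ℝ) := by
      rw [hX₀]; push_cast; linarith [Nat.le_ceil |x|]
    rw [h3]
    exact mul_le_mul_of_nonneg_right (h1.trans h4) hqpos.le
  have hmax : max |p| (q : ℤ) ≤ (X₀ : ℤ) * q := by
    refine max_le ?_ ?_
    · have : (|(p : ℝ)| : ℝ) ≤ (X₀ : ℝ) * q := hpq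
      have h' : ((|p| : ℤ) : ℝ) ≤ (((X₀ : ℤ) * q : ℤ) : ℝ) := by push_cast; rwa [← Int.cast_abs] at this
      exact_mod_cast h'
    · have : (1 : ℤ) ≤ X₀ := by exact_mod_cast hX₀1
      nlinarith
  obtain ⟨hLmax, hXq⟩ := expRational_sizes L X₀ D q p hL1 hX₀1 hq1 hmax
  have hQZ : ((L * X₀ ^ (D + 1) * q ^ (D + 1) : ℕ) : ℤ) = (Q : ℤ) := by rw [hQ, hc₁]
  rw [hQZ] at hLmax hXq
  have hQH' : (Q : ℤ) ≤ H := by exact_mod_cast hQH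
  have huH : |u| ≤ (H : ℤ) := hu.trans (hLmax.trans hQH')
  have hvH : |v| ≤ (H : ℤ) := hv.trans (hLmax.trans hQH')
  have hqH' : (q : ℤ) ≤ H := by exact_mod_cast hqH
  have hpH : |p| ≤ (H : ℤ) := ((le_max_left _ _).trans hmax).trans (hXq.trans hQH')
  -- admissibility of the challenger at level (n, H)
  obtain ⟨hfr, hcl⟩ := stub_expRationalLevel n H q p u v α P hn1 hq1 hqH' hpH hu0 huH hvH hP0 hPα
    hPdeg hPcoef
  have key := hH₀ H (Sum.elim ![(1 : ℂ), (p : ℂ) / q] ![α, (v : ℂ) / u]) hH₀H hfr hcl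
  -- its distance: the slot w = v/u = B(t)/A(t) is K|x − t|-close to eˣ = B(x)/A(x)
  set w : ℝ := Polynomial.aeval ((p : ℝ) / q) B / Polynomial.aeval ((p : ℝ) / q) A with hw
  have hwexp : |w - Real.exp x| ≤ K * |x - (p : ℝ) / q| := by
    have hex : Real.exp x = Polynomial.aeval x B / Polynomial.aeval x A := by
      rw [eq_div_iff hA, mul_comm]; exact hrel
    rw [hex, abs_sub_comm x]
    exact hLipt
  have hwC : ((w : ℝ) : ℂ) = (v : ℂ) / u := by
    have hu0R : (u : ℝ) ≠ 0 := by exact_mod_cast hu0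
    have hwr : w = (v : ℝ) / u := by
      rw [eq_div_iff hu0R, mul_comm]; exact huv
    rw [hwr]; push_cast; rfl
  have hdist := stub_expRationalDist p q x w K α hK1 hwexp
  rw [hwC] at hdist
  have h2 : K * |x - (p : ℝ) / q| ≤ K * (1 / (q : ℝ) ^ m) := mul_le_mul_of_nonneg_left hclose hK0
  have h3 := max_le_max hqual h2
  have hqHR : (q : ℝ) ≤ H := by exact_mod_cast hqH
  have hHq : (H : ℝ) ≤ (q : ℝ) ^ (((D : ℝ) + 2) * M₀) :=
    height_window_rpow c₁ q D M₀ H hc₁1 hc₁q hM₀ hHQ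
  have h4 := hfin (q : ℝ) (H : ℝ) hq₀q hqHR hHq
  linarith [key, hdist, h3, h4]

/-- **Corollary: the crux forbids every Lambert number `W(v/u)` (`u, v ≥ 1`) to be Liouville.**  The point
`x = W(v/u)` (`u x eˣ = v`, so `x > 0`) is the exp-rational point `A = uX`, `B = v`, non-degenerate since
`eˣ(ux + u) = u eˣ (x + 1) ≠ 0`. [folklore] -/
theorem notLiouville_lambertW_of_ev (hEv : KhovanskiiApproxTypeEv) (u v : ℕ) (x : ℝ) (hu : 1 ≤ u)
    (hv : 1 ≤ v) (hx : (u : ℝ) * x * Real.exp x = v) : ¬ Liouville x := by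
  have hupos : (0 : ℝ) < u := by exact_mod_cast hu
  have hvpos : (0 : ℝ) < v := by exact_mod_cast hv
  -- x > 0: u x eˣ = v > 0
  have hx0 : 0 < x := by
    by_contra h
    push Not at h
    have : (u : ℝ) * x * Real.exp x ≤ 0 :=
      mul_nonpos_of_nonpos_of_nonneg (mul_nonpos_of_nonneg_of_nonpos hupos.le h) (Real.exp_pos x).le
    linarith
  have e1 : Polynomial.aeval x (Polynomial.C (u : ℤ) * Polynomial.X) = (u : ℝ) * x := by simp
  have e2 : Polynomial.aeval x (Polynomial.C (v : ℤ)) = (v : ℝ) := by simp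
  have e3 : Polynomial.aeval x (derivative (Polynomial.C (u : ℤ) * Polynomial.X)) = (u : ℝ) := by simp
  have e4 : Polynomial.aeval x (derivative (Polynomial.C (v : ℤ))) = 0 := by simp
  refine notLiouville_expRational_of_ev hEv (Polynomial.C (u : ℤ) * Polynomial.X) (Polynomial.C (v : ℤ)) x
    ?_ ?_
  · rw [e1, e2]; linarith [hx]
  · rw [e1, e3, e4]
    have h1 : 0 < Real.exp x * ((u : ℝ) * x + u) := by positivity
    exact h1.ne'

end Summit.Schanuel.Schanuel.Cruxes.KhovanskiiApproxTypeEv.LambertLiouvilleKill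

end
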